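/-
Copyright (c) 2026 the pub-hodgecm-mathlib formalisation cell (harness21).  Prover seat hodgecm-mathlib-K2E3-p17 (g0),
Track B «K2-LIT» ∕ h413, unit U5Kazhdan of the line `K2_E3_EllipticInputs`, socket #17 `sig_K2E3PseudoCoeffExistsElliptic`
(`Cruxes/H413/Lines/K2_E3_EllipticInputsSigs_U5Kazhdan.lean` 87d8b4c974a167d7 :275–373): KOTTWITZ'S EULER–POINCARÉ FUNCTION AT EVERY
NON-SPLIT PLACE, AND THE KIND-2 PART OF #17 AT EVERY NON-SPLIT PLACE (★ #21 p854998 composed with ★ p855014).  2026-09-03.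
-/
import Summits.HodgeConjecture.HodgeConjecture.Theorems.K2E3PseudoCoeffExistsEllipticStDetOfEP   -- ★ p855014 (this seat): `exists_isPseudoCoeff_detG_stG_of_epFunction_of_eSt` (kind 2 ⟸ EP by shape)
import Summits.HodgeConjecture.HodgeConjecture.Theorems.K2E3EPFunctionGWild                    -- ★ p854998 (K2E3-p21): socket #21 `epFunctionGWild` (EP by shape at a wild place)
import Summits.HodgeConjecture.HodgeConjecture.Theorems.F0P3cStCharTSEPGlueGNotWild             -- ★ (G3)-NOT-WILD: `exists_epFunction_G`, `exists_epFunction_G_of_ramificationIdx'_or_valued_two`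
import Literature.NumberTheory.Rogawski1990.ValuedTwoPlacesOver                                 -- ★ `valued_two_eq_one_iff_of_placesOver`
import Literature.NumberTheory.Automorphic.UnitaryThreeRegularUnipotentOrbitFrameDyadic                -- ★ `valued_v_two_le_one` (`|2| ≤ 1` in any valued field)
import HarnessLib

/-!
# K2_E3 road (h413 = stmt-HodgeConjecture-24833), unit U5Kazhdan, socket #17 `sig_K2E3PseudoCoeffExistsElliptic` — KOTTWITZ'S EULER–POINCARÉ
# FUNCTION ON `U(Φ₃)(L⁺_v)` AT EVERY NON-SPLIT PLACE, and the kind-2 classes `St_G(ψ)`, `ψ∘det_G` have pseudo-coefficients AT EVERY NON-SPLIT PLACE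

Cell `pub/hodgecm-mathlib` (D-0151), Track B (21-frontier RULING «PUSH BOTH» 2026-09-03), socket module
`Summits/HodgeConjecture/HodgeConjecture/Cruxes/H413/Lines/K2_E3_EllipticInputsSigs_U5Kazhdan.lean` (87d8b4c974a167d7), socket **`sig_K2E3PseudoCoeffExistsElliptic`**
(SIGS-TABLE-K2E3 row #17, XL).  State of the row: ★ p854976 (NOT-WILD head: every class at a not-wild place), ★ p855014 (kind 2 ⟸ an Euler–Poincaré function BY
SHAPE), ★ p855073 (the by-name payer modulo the wild non-supercuspidal head).  Socket #21 `sig_K2E3EPFunctionGWild` is ★ p854998 (K2E3-p21, over Track A's wild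
lattice tree), so the place trichotomy now yields an Euler–Poincaré function BY SHAPE at EVERY non-split place: unramified ★ (G3) `exists_epFunction_G`, ramified with
`|2|_w = 1` ★ (G3)-RAM (`exists_epFunction_G_of_ramificationIdx'_or_valued_two`), ramified with `|2|_w < 1` ★ #21 `epFunctionGWild`.  Composed with ★ p855014 §3
this pays the KIND-2 part of #17 — `ψ∘det_G` and `St_G(ψ)` for every continuous character `ψ` of the centre — at EVERY non-split place from the socket's pin `eSt` alone,
the latter with `f(1)` a positive real (POS-ONE at `St_G(ψ)`, row #20's `St` instance, every place).
* §1 **`exists_epFunction_G_all`** (`|2|_w ≤ 1` by ★ `valued_v_two_le_one`) — the eight EP clauses at EVERY non-split `v` (binders `hns νQv mQv hcanQ` only).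
* §2 **`exists_isPseudoCoeff_detG_stG_all`** — `∀ ψ` continuous: `(∃ f, IsPseudoCoeff (ψ∘det_G) f) ∧ (∃ f, IsPseudoCoeff (St_G(ψ)) f ∧ 0 < re f(1) ∧ im f(1) = 0)` at EVERY
  non-split `v`, binders = the socket's `hns νQv mQv hcanQ μZ 𝔇 hC01 hC04 hC05 hE hchar` + the pin `eSt` VERBATIM.
So the OPEN residue of #17 is exactly: the elliptic classes that are neither supercuspidal nor of kind 2 — `π²(ξ)`, `πⁿ(ξ)` and the l.d.s. members — at a WILD place
(the wild twin of the K-type Euler–Poincaré road ★ `F0P3cStCharTSK1NotWildPseudoCoeff`, over the same wild tree).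

HONEST LABEL: HC_CM is proved only modulo the 7 printed citations (2 remaining named inputs: hLiu418 = stmt-HodgeConjecture-24832, h413 =
stmt-HodgeConjecture-24833) until rung 0 closes; this file is a `--supports stmt-HodgeConjecture-24833` helper (a rung of #17) and retires nothing by itself.

## References
* [Kottwitz1988] R. E. Kottwitz, *Tamagawa numbers*, Ann. of Math. 127 (1988), §2 Theorem 2.
* [Rogawski1990] J. D. Rogawski, *Automorphic Representations of Unitary Groups in Three Variables*, Ann. of Math. Stud. 123 (1990), §12.2 (1) p. 173, §12.6 p. 187,
  Prop. 12.6.1 (c) p. 188.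
* [Tits1979] J. Tits, *Reductive groups over local fields*, PSPM 33.1 (1979), §2.7.
-/

set_option autoImplicit false
-- the mandated namespace has the single-problem summit's repeated segment (`HodgeConjecture.HodgeConjecture`)
set_option linter.dupNamespace false

noncomputable section

open NumberField IsDedekindDomain MeasureTheory Filter Topology
open scoped Matrix MatrixGroups Valued
open Literature.NumberTheory.Rogawski1990 Literature.NumberTheory.Rogawski1990.Ch12Sec5
open Literature.NumberTheory.Automorphic Literature.NumberTheory.Automorphic.UnitaryGroup

namespace Summit.HodgeConjecture.HodgeConjecture.Cruxes.H413.K2E3PseudoCoeffExistsEllipticEPAllPlaces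

open Summit.HodgeConjecture.HodgeConjecture.Cruxes.H413
open Summit.HodgeConjecture.HodgeConjecture.Cruxes.H413.F0P3cStCharTSTorusDefs
open Summit.HodgeConjecture.HodgeConjecture.Cruxes.H413.F0P3cStCharTSEPGlueG (exists_epFunction_G)
open Summit.HodgeConjecture.HodgeConjecture.Cruxes.H413.F0P3cStCharTSEPGlueGNotWild (exists_epFunction_G_of_ramificationIdx'_or_valued_two)
open Summit.HodgeConjecture.HodgeConjecture.Cruxes.H413.K2E3EPFunctionGWild (epFunctionGWild)
open Summit.HodgeConjecture.HodgeConjecture.Cruxes.H413.K2E3PseudoCoeffExistsEllipticStDetOfEP (exists_isPseudoCoeff_detG_stG_of_epFunction_of_eSt)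
open Literature.NumberTheory.Automorphic.Liu2021.LemD1IndexedNonVacuityTameSynthesis (isUnramifiedIn_of_ramificationIdx'_eq_one)

variable (L : Type) [Field L] [NumberField L] [IsCMField L] (v : HeightOneSpectrum (𝓞 ↥(maximalRealSubfield L)))

/-! ## §1  Kottwitz's Euler–Poincaré function BY SHAPE at every non-split place -/

set_option maxHeartbeats 1600000 in
-- statement-level instance-term unification on the CM local carriers (the budget line of ★ (G3) ∕ ★ #21 themselves)
/-- **KOTTWITZ'S EULER–POINCARÉ FUNCTION ON `G_v = U(Φ₃)(L⁺_v)` AT EVERY NON-SPLIT PLACE** — the eight clauses (locally constant compactly supported, measurable,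
integrable, mass one, `f_G(1)` real negative, canonical orbital integral `1` at the regular classes with compact centraliser and `0` at those with non-compact
centraliser) for every Haar `νQv` and every family `mQv` canonical for (`IsRegularElt`, `νQv`).  Place trichotomy at any `w ∣ v`: `e(w∣v) = 1` ⇒ `v` unramified in `L`
(★ `isUnramifiedIn_of_ramificationIdx'_eq_one`) ⇒ ★ (G3) `exists_epFunction_G`; `e(w∣v) ≠ 1`, `|2|_w = 1` ⇒ ★ (G3)-RAM (`exists_epFunction_G_of_ramificationIdx'_or_valued_two`);
`e(w∣v) ≠ 1`, `|2|_w < 1` ⇒ ★ socket #21 `K2E3EPFunctionGWild.epFunctionGWild` (Track A's wild lattice tree).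
[cite: Kottwitz1988, §2 Theorem 2] [cite: Rogawski1990, §12.6 p. 187] [cite: Tits1979, §2.7 (p. 48)] -/
theorem exists_epFunction_G_all
    (hns : ∀ w : PlacesOver L v, IsCMField.complexConj L • w.1 = w.1)
    [MeasurableSpace (Gqs L v)] [BorelSpace (Gqs L v)]
    [∀ γ : Gqs L v, MeasurableSpace (Gqs L v ⧸ Subgroup.centralizer ({γ} : Set (Gqs L v)))]
    [∀ γ : Gqs L v, BorelSpace (Gqs L v ⧸ Subgroup.centralizer ({γ} : Set (Gqs L v)))]
    (νQv : Measure (Gqs L v)) [νQv.IsHaarMeasure] [νQv.IsMulRightInvariant] (mQv : OrbitalMeasureFamily (Gqs L v))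
    (hcanQ : mQv.IsCanonical (fun γ => IsRegularElt (γ.val : GL (Fin 3) (UnitaryGroup.LocalRing L v))) νQv) :
    ∃ fG : Gqs L v → ℂ, IsLocSmooth fG ∧ Measurable fG ∧ Integrable fG νQv ∧ ∫ g, fG g ∂νQv = 1 ∧
      (fG 1).im = 0 ∧ (fG 1).re < 0 ∧
      (∀ γ : Gqs L v, IsRegularElt (γ.val : GL (Fin 3) (UnitaryGroup.LocalRing L v)) →
        IsCompact ((Subgroup.centralizer ({γ} : Set (Gqs L v))) : Set (Gqs L v)) → classOrbitalIntegral mQv fG (ConjClasses.mk γ) = 1) ∧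
      (∀ γ : Gqs L v, IsRegularElt (γ.val : GL (Fin 3) (UnitaryGroup.LocalRing L v)) →
        ¬ IsCompact ((Subgroup.centralizer ({γ} : Set (Gqs L v))) : Set (Gqs L v)) → classOrbitalIntegral mQv fG (ConjClasses.mk γ) = 0) := by
  obtain ⟨w⟩ : Nonempty (PlacesOver L v) := inferInstance
  have hw : IsCMField.complexConj L • w.1 = w.1 := hns w
  by_cases he : v.asIdeal.ramificationIdx' w.1.asIdeal = 1
  · haveI : Algebra.IsQuadraticExtension ↥(maximalRealSubfield L) L := IsCMField.isQuadraticExtension L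
    exact exists_epFunction_G L v hns
      (isUnramifiedIn_of_ramificationIdx'_eq_one L (IsCMField.complexConj L) v (IsCMField.complexConj_ne_one L) w hw he) νQv hcanQ
  · by_cases h2 : Valued.v (2 : w.1.adicCompletion L) = 1
    · exact exists_epFunction_G_of_ramificationIdx'_or_valued_two L v hns w (Or.inr h2) νQv hcanQ
    · exact epFunctionGWild L v hns w he (lt_of_le_of_ne UnitaryGroup.valued_v_two_le_one h2) νQv mQv hcanQ

/-! ## §2  The kind-2 classes have pseudo-coefficients at every non-split place -/

set_option maxHeartbeats 1600000 in
set_option synthInstance.maxHeartbeats 400000 in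
-- statement-level instance-term unification on the CM local carriers (as ★ p855014 §3, same frame)
/-- **THE KIND-2 PART OF #17 AT EVERY NON-SPLIT PLACE**: for every continuous character `ψ` of the centre of `G_v = U(Φ₃)(L⁺_v)`, `ψ∘det_G` has a pseudo-coefficient and
`St_G(ψ)` has one with `f(1)` a positive real — at the socket's datum, from its pins `hC01 hC04 hC05 hE hchar` and `eSt` VERBATIM (binders = ★ p855014 §3's without `hEP`,
which §1 supplies).  Print: «The existence of pseudo-coefficients follows from [K], Theorem 4.1» [Rogawski1990, §12.6 p. 187] — here, for the kind-2 classes, from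
Kottwitz's Euler–Poincaré function at every place and `χ_{St} = −ψ∘det` on `G^e` [Prop. 12.6.1 (c) p. 188].
[cite: Rogawski1990, §12.6 p. 187; Prop. 12.6.1 (c) p. 188; §12.2 (1) p. 173] [cite: Kottwitz1988, §2 Theorem 2] -/
theorem exists_isPseudoCoeff_detG_stG_all
    (hns : ∀ w : PlacesOver L v, IsCMField.complexConj L • w.1 = w.1)
    [MeasurableSpace (Gqs L v)] [BorelSpace (Gqs L v)]
    [∀ γ : Gqs L v, MeasurableSpace (Gqs L v ⧸ Subgroup.centralizer ({γ} : Set (Gqs L v)))]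
    [∀ γ : Gqs L v, BorelSpace (Gqs L v ⧸ Subgroup.centralizer ({γ} : Set (Gqs L v)))]
    [MeasurableSpace (Gqs L v ⧸ Subgroup.center (Gqs L v))]
    {H : Type} [Group H] [TopologicalSpace H] [IsTopologicalGroup H] [MeasurableSpace H]
    (νQv : Measure (Gqs L v)) [νQv.IsHaarMeasure] [νQv.IsMulRightInvariant] (mQv : OrbitalMeasureFamily (Gqs L v))
    (hcanQ : mQv.IsCanonical (fun γ => IsRegularElt (γ.val : GL (Fin 3) (UnitaryGroup.LocalRing L v))) νQv)
    (μZ : Measure (Gqs L v ⧸ Subgroup.center (Gqs L v)))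
    (𝔇 : EllipticData (Gqs L v) H) (hC01 : 𝔇.μG = νQv) (hC04 : 𝔇.orb = mQv)
    (hC05 : ∀ γ : Gqs L v, γ ∈ 𝔇.regG ↔ IsRegularElt (γ.val : GL (Fin 3) (UnitaryGroup.LocalRing L v)))
    (hE : ∀ γ : Gqs L v, γ ∈ 𝔇.ellG ↔ IsRegularElt (γ.val : GL (Fin 3) (UnitaryGroup.LocalRing L v)) ∧ γ ∉ hyperbolicSet L v)
    (hchar : ∀ π : IrrClass (Gqs L v), Measurable (𝔇.char π) ∧ LocallyIntegrable (𝔇.char π) 𝔇.μG ∧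
      (∀ x ∈ 𝔇.regG, ∀ᶠ y in 𝓝 x, 𝔇.char π y = 𝔇.char π x) ∧
      ∀ φ : Gqs L v → ℂ, IsLocSmooth φ → π.smoothTrace 𝔇.μG φ = ∫ x, φ x * 𝔇.char π x ∂𝔇.μG)
    -- ══ the socket's pin `eSt`, VERBATIM ══
    (eSt : ∃ (ιZ : ↥(normOneUnits (conjLocal L (IsCMField.complexConj L) v)) →* ↥(Subgroup.center (Gqs L v))) (detZ : (Gqs L v) →* ↥(Subgroup.center (Gqs L v))), Continuous ιZ ∧ Continuous detZ ∧ (∀ z : ↥(normOneUnits (conjLocal L (IsCMField.complexConj L) v)), ((ιZ z).val.val.val : Matrix (Fin 3) (Fin 3) (UnitaryGroup.LocalRing L v)) = (((z : (UnitaryGroup.LocalRing L v)ˣ) : UnitaryGroup.LocalRing L v)) • (1 : Matrix (Fin 3) (Fin 3) (UnitaryGroup.LocalRing L v))) ∧ (∀ g : (Gqs L v), ((detZ g).val.val.val : Matrix (Fin 3) (Fin 3) (UnitaryGroup.LocalRing L v)) = (g.val.val : Matrix (Fin 3) (Fin 3) (UnitaryGroup.LocalRing L v)).det • (1 : Matrix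 (Fin 3) (Fin 3) (UnitaryGroup.LocalRing L v))) ∧ ∀ ψ : ↥(Subgroup.center (Gqs L v)) →* ℂˣ, Continuous ψ → (∃ hopen : IsOpen (((ψ.comp detZ).ker : Subgroup (Gqs L v)) : Set (Gqs L v)), 𝔇.detG ψ = IrrClass.mk (SmoothIrrep.ofChar (ψ.comp detZ) hopen)) ∧ 𝔇.stG ψ ≠ 𝔇.detG ψ ∧ (∀ c : IrrClass (Gqs L v), c.IsConstituentOf (cmPrincipalSeries L 3 v (cmTorusCharPair L v (halfModulusChar (UnitaryGroup.LocalRing L v) * halfModulusChar (UnitaryGroup.LocalRing L v))⁻¹ (ψ.comp ιZ))) ↔ (c = 𝔇.stG ψ ∨ c = 𝔇.detG ψ)) ∧ (𝔇.stG ψ).IsSquareIntegrable μZ ∧ ¬ (𝔇.detG ψ).IsSquareIntegrable μZ) :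
    ∀ ψ : ↥(Subgroup.center (Gqs L v)) →* ℂˣ, Continuous ψ →
      (∃ f : Gqs L v → ℂ, 𝔇.IsPseudoCoeff (𝔇.detG ψ) f) ∧
        (∃ f : Gqs L v → ℂ, 𝔇.IsPseudoCoeff (𝔇.stG ψ) f ∧ 0 < (f 1).re ∧ (f 1).im = 0) :=
  exists_isPseudoCoeff_detG_stG_of_epFunction_of_eSt L v hns νQv mQv hcanQ μZ 𝔇 hC01 hC04 hC05 hE hchar
    (exists_epFunction_G_all L v hns νQv mQv hcanQ) eSt

end Summit.HodgeConjecture.HodgeConjecture.Cruxes.H413.K2E3PseudoCoeffExistsEllipticEPAllPlaces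

end
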